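import Literature.Topology.Euclidean.LatticeCubeFaces
import HarnessLib

/-!
# Skeleta of lattice cube complexes and faces through a point

Topic `Literature/Topology/Euclidean`, continuing `LatticeCubeComplex.lean` (lattice `h ℤᴺ` in
`ℝᴺ = Fin N → ℝ`, faces `LatticeCube.Face`, finite cube complexes `LatticeCube.complex 𝒬 h`) and
`LatticeCubeFaces.lean` (boundary faces: `Face.exists_mem_carrier_bdFace`, `bdFace_mem_faces`,
corners). This is the mesh-`h` / `Face`-structure counterpart of the unit-grid skeleta
`Literature.AlgebraicTopology.Homotopy.Cubical.skel` of `CubicalSets.lean` (same notions: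
`skel_mono`, closedness, boundary in the lower skeleton), on the `LatticeCube` base that carries
the accepted CW structure `LatticeCube.cwComplex`.
Elementary combinatorial geometry needed for cellular approximation on cube complexes
(Hatcher, *Algebraic Topology* (2002), §4.1, proof of Thm. 4.8 — done there for general CW
complexes; here everything is explicit for cubes):

* `LatticeCube.skel 𝒬 h m`: the `m`-skeleton, the union of the closed faces of dimension `≤ m`
  of the cubes of `𝒬`; closed, increasing, `skel 𝒬 h N = complex 𝒬 h`;
* `LatticeCube.Face.eq_of_mem_relint_of_mem_carrier`: a closed face of dimension `≤ m`
  meeting the relative interior of an `m`-face *is* that face; hence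
  (`LatticeCube.Face.disjoint_relint_carrier`) open `m`-faces are disjoint from the other closed
  faces of dimension `≤ m`, (`LatticeCube.Face.not_mem_skel_of_mem_relint`) from the lower
  skeleta, and `skel 𝒬 h m ∖ relint G` is the union of the other closed faces, hence closed
  (`LatticeCube.skel_diff_relint_eq`, `LatticeCube.isClosed_skel_diff_relint`);
* `LatticeCube.Face.isFaceOf_of_mem_relint_of_mem_top`: a face whose relative interior meets a
  closed cube is a face of that cube;
* `LatticeCube.Face.mem_skel_of_mem_carrier_diff_relint`: the boundary of an `m`-face lies in the
  `(m - 1)`-skeleton (via `Face.exists_mem_carrier_bdFace` of `LatticeCubeFaces.lean`);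
  `LatticeCube.Face.isClosed_carrier`, `LatticeCube.Face.isCompact_carrier`: closed faces are
  closed and compact (upstream has the top-cube case).

No `sorry`; [folklore] throughout.

## References

* A. Hatcher, *Algebraic Topology*, CUP (2002), §4.1 (skeleta, cellular maps), Appendix
  (cube complexes in the proof of Thm. A.7). [HatcherAT2002]
-/

noncomputable section

open Set Topology Function

namespace Literature.Topology.Euclidean

namespace LatticeCube

variable {N : ℕ} {h : ℝ}

/-! ### Integer squeezes -/

/-- An integer multiple of `h > 0` strictly between `a h` and `(a + 1) h` does not exist.
[folklore] -/
theorem int_not_mem_Ioo (hh : 0 < h) (a z : ℤ) :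
    ¬ ((a : ℝ) * h < (z : ℝ) * h ∧ (z : ℝ) * h < ((a : ℝ) + 1) * h) := by
  rintro ⟨h1, h2⟩
  have h1' : (a : ℝ) < z := lt_of_mul_lt_mul_right h1 hh.le
  have h2' : (z : ℝ) < a + 1 := lt_of_mul_lt_mul_right h2 hh.le
  have h3 : a < z := by exact_mod_cast h1'
  have h4 : z < a + 1 := by exact_mod_cast h2'
  omega

/-- If `a h ≤ x ≤ (a + 1) h` and `b h < x < (b + 1) h` then `a = b`. [folklore] -/
theorem int_eq_of_mem_Icc_of_mem_Ioo (hh : 0 < h) {a b : ℤ} {x : ℝ}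
    (ha : (a : ℝ) * h ≤ x ∧ x ≤ ((a : ℝ) + 1) * h) (hb : (b : ℝ) * h < x ∧ x < ((b : ℝ) + 1) * h) :
    a = b := by
  have h1 : (a : ℝ) * h < ((b : ℝ) + 1) * h := lt_of_le_of_lt ha.1 hb.2
  have h2 : (b : ℝ) * h < ((a : ℝ) + 1) * h := lt_of_lt_of_le hb.1 ha.2
  have h1' : (a : ℝ) < b + 1 := lt_of_mul_lt_mul_right h1 hh.le
  have h2' : (b : ℝ) < a + 1 := lt_of_mul_lt_mul_right h2 hh.le
  have h3 : a < b + 1 := by exact_mod_cast h1'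
  have h4 : b < a + 1 := by exact_mod_cast h2'
  omega

/-- If `b h ≤ a h ≤ (b + 1) h` then `a = b` or `a = b + 1`. [folklore] -/
theorem int_eq_or_of_mem_Icc (hh : 0 < h) {a b : ℤ}
    (hab : (b : ℝ) * h ≤ (a : ℝ) * h ∧ (a : ℝ) * h ≤ ((b : ℝ) + 1) * h) : a = b ∨ a = b + 1 := by
  have h1 : (b : ℝ) ≤ a := le_of_mul_le_mul_right hab.1 hh
  have h2 : (a : ℝ) ≤ b + 1 := le_of_mul_le_mul_right hab.2 hh
  have h3 : b ≤ a := by exact_mod_cast h1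
  have h4 : a ≤ b + 1 := by exact_mod_cast h2
  omega

namespace Face

/-! ### Faces through a point -/

/-- **A closed face of dimension `≤ m` meeting the relative interior of an `m`-face is that
face.** [folklore] -/
theorem eq_of_mem_relint_of_mem_carrier (hh : 0 < h) {F G : Face N} {x : Fin N → ℝ}
    (hG : x ∈ G.relint h) (hF : x ∈ F.carrier h) (hcard : F.S.card ≤ G.S.card) : F = G := by
  -- the free directions of `G` are free for `F`
  have hS : G.S ⊆ F.S := by
    intro i hi
    by_contra hiF
    have h1 := (hG i).1 hi
    have h2 := (hF i).2 hiF
    rw [h2] at h1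
    exact int_not_mem_Ioo hh (G.a i) (F.a i) h1
  have hSeq : F.S = G.S := (Finset.eq_of_subset_of_card_le hS hcard).symm
  ext i
  · by_cases hi : i ∈ G.S
    · exact int_eq_of_mem_Icc_of_mem_Ioo hh ((hF i).1 (hSeq ▸ hi)) ((hG i).1 hi)
    · have h1 := (hG i).2 hi
      have h2 := (hF i).2 (hSeq ▸ hi)
      rw [h1] at h2
      have := mul_right_cancel₀ hh.ne' h2
      exact_mod_cast this.symm
  · rw [hSeq]

/-- Distinct faces of dimension `≤ m`: the relative interior of the `m`-dimensional one avoids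
the other closed face. [folklore] -/
theorem disjoint_relint_carrier (hh : 0 < h) {F G : Face N} (hne : F ≠ G)
    (hcard : F.S.card ≤ G.S.card) : Disjoint (G.relint h) (F.carrier h) :=
  disjoint_left.2 fun _ hG hF => hne (eq_of_mem_relint_of_mem_carrier hh hG hF hcard)

/-- **A face whose relative interior meets the closed cube `b` is a face of `b`.** [folklore] -/
theorem isFaceOf_of_mem_relint_of_mem_top (hh : 0 < h) {G : Face N} {b : Fin N → ℤ}
    {y : Fin N → ℝ} (hG : y ∈ G.relint h) (hb : y ∈ (top N b).carrier h) : G.IsFaceOf b := by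
  rw [mem_carrier_top] at hb
  intro i
  constructor
  · intro hi
    exact int_eq_of_mem_Icc_of_mem_Ioo hh (hb i) ((hG i).1 hi) |>.symm
  · intro hi
    have h1 := (hG i).2 hi
    have h2 := hb i
    rw [h1] at h2
    exact int_eq_or_of_mem_Icc hh h2

/-- Closed faces are closed. [folklore] -/
theorem isClosed_carrier (F : Face N) (h : ℝ) : IsClosed (F.carrier h) := by
  have h1 : F.carrier h = ⋂ i, ({x : Fin N → ℝ | i ∈ F.S → (F.a i : ℝ) * h ≤ x i ∧
      x i ≤ ((F.a i : ℝ) + 1) * h} ∩ {x | i ∉ F.S → x i = (F.a i : ℝ) * h}) := by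
    ext x
    simp only [mem_iInter, mem_inter_iff, mem_setOf_eq]
    exact ⟨fun hx i => hx i, fun hx i => hx i⟩
  rw [h1]
  refine isClosed_iInter fun i => IsClosed.inter ?_ ?_
  · by_cases hi : i ∈ F.S
    · have : {x : Fin N → ℝ | i ∈ F.S → (F.a i : ℝ) * h ≤ x i ∧ x i ≤ ((F.a i : ℝ) + 1) * h} =
          {x | (F.a i : ℝ) * h ≤ x i} ∩ {x | x i ≤ ((F.a i : ℝ) + 1) * h} := by
        ext x; simp [hi]
      rw [this]
      exact (isClosed_le continuous_const (continuous_apply i)).inter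
        (isClosed_le (continuous_apply i) continuous_const)
    · have : {x : Fin N → ℝ | i ∈ F.S → (F.a i : ℝ) * h ≤ x i ∧ x i ≤ ((F.a i : ℝ) + 1) * h} =
          univ := by
        ext x; simp [hi]
      rw [this]; exact isClosed_univ
  · by_cases hi : i ∈ F.S
    · have : {x : Fin N → ℝ | i ∉ F.S → x i = (F.a i : ℝ) * h} = univ := by
        ext x; simp [hi]
      rw [this]; exact isClosed_univ
    · have : {x : Fin N → ℝ | i ∉ F.S → x i = (F.a i : ℝ) * h} = {x | x i = (F.a i : ℝ) * h} := by
        ext x; simp [hi]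
      rw [this]
      exact isClosed_eq (continuous_apply i) continuous_const

/-- Closed faces are compact (closed and coordinatewise bounded; any real `h`). [folklore] -/
theorem isCompact_carrier (F : Face N) (h : ℝ) : IsCompact (F.carrier h) := by
  refine (isCompact_univ_pi fun i => (isCompact_Icc :
    IsCompact (Icc (min ((F.a i : ℝ) * h) (((F.a i : ℝ) + 1) * h))
      (max ((F.a i : ℝ) * h) (((F.a i : ℝ) + 1) * h))))).of_isClosed_subset
    (F.isClosed_carrier h) fun x hx => ?_
  rw [Set.mem_univ_pi]
  intro i
  by_cases hi : i ∈ F.S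
  · obtain ⟨h1, h2⟩ := (hx i).1 hi
    exact ⟨(min_le_left _ _).trans h1, h2.trans (le_max_right _ _)⟩
  · rw [(hx i).2 hi]
    exact ⟨min_le_left _ _, le_max_left _ _⟩

end Face

/-! ### Skeleta -/

/-- **The `m`-skeleton** of the cube complex: the union of the closed faces of dimension `≤ m`
of the cubes of `𝒬`. [folklore] -/
def skel (𝒬 : Finset (Fin N → ℤ)) (h : ℝ) (m : ℕ) : Set (Fin N → ℝ) :=
  ⋃ F ∈ {F : Face N | F ∈ faces 𝒬 ∧ F.S.card ≤ m}, F.carrier h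

variable {𝒬 : Finset (Fin N → ℤ)}

/-- Membership in the skeleton. [folklore] -/
theorem mem_skel {m : ℕ} {x : Fin N → ℝ} :
    x ∈ skel 𝒬 h m ↔ ∃ F : Face N, F ∈ faces 𝒬 ∧ F.S.card ≤ m ∧ x ∈ F.carrier h := by
  simp only [skel, mem_setOf_eq, mem_iUnion, exists_prop, and_assoc]

/-- A closed face of dimension `≤ m` of the complex lies in the `m`-skeleton. [folklore] -/
theorem carrier_subset_skel {m : ℕ} {F : Face N} (hF : F ∈ faces 𝒬) (hm : F.S.card ≤ m) :
    F.carrier h ⊆ skel 𝒬 h m := fun _ hx => mem_skel.2 ⟨F, hF, hm, hx⟩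

/-- Skeleta increase. [folklore] -/
theorem skel_mono {m m' : ℕ} (hm : m ≤ m') : skel 𝒬 h m ⊆ skel 𝒬 h m' := fun _ hx => by
  obtain ⟨F, hF, hFm, hx⟩ := mem_skel.1 hx
  exact mem_skel.2 ⟨F, hF, hFm.trans hm, hx⟩

/-- Skeleta lie in the complex (`h ≥ 0`). [folklore] -/
theorem skel_subset_complex (hh : 0 ≤ h) (m : ℕ) : skel 𝒬 h m ⊆ complex 𝒬 h := fun _ hx => by
  obtain ⟨F, hF, -, hx⟩ := mem_skel.1 hx
  exact carrier_subset_complex hh hF hx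

/-- The top skeleton is the complex. [folklore] -/
theorem skel_eq_complex (hh : 0 ≤ h) {m : ℕ} (hm : N ≤ m) : skel 𝒬 h m = complex 𝒬 h := by
  refine Subset.antisymm (skel_subset_complex hh m) fun x hx => ?_
  obtain ⟨b, hb, hxb⟩ := mem_complex.1 hx
  refine mem_skel.2 ⟨Face.top N b, ⟨b, hb, Face.top_isFaceOf b⟩, ?_, hxb⟩
  simpa using (Finset.card_le_univ (Finset.univ : Finset (Fin N))).trans (by simpa using hm)

/-- Skeleta are closed. [folklore] -/
theorem isClosed_skel (m : ℕ) : IsClosed (skel 𝒬 h m) :=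
  ((faces_finite 𝒬).subset fun _ hF => hF.1).isClosed_biUnion fun F _ => F.isClosed_carrier h

/-- **The boundary of an `m`-face of the complex lies in the `(m - 1)`-skeleton.** [folklore] -/
theorem Face.mem_skel_of_mem_carrier_diff_relint {F : Face N} (hF : F ∈ faces 𝒬) {m : ℕ}
    (hm : F.S.card ≤ m + 1) {x : Fin N → ℝ} (hx : x ∈ F.carrier h) (hx' : x ∉ F.relint h) :
    x ∈ skel 𝒬 h m := by
  obtain ⟨i₀, hi₀, up, hxi⟩ := F.exists_mem_carrier_bdFace hx hx'
  refine mem_skel.2 ⟨F.bdFace i₀ up, bdFace_mem_faces hF hi₀ up, ?_, hxi⟩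
  rw [Face.card_bdFace_S hi₀]; omega

/-- The relative interior of an `m`-face avoids the `(m - 1)`-skeleton. [folklore] -/
theorem Face.not_mem_skel_of_mem_relint (hh : 0 < h) {G : Face N} {m : ℕ} (hm : m < G.S.card)
    {x : Fin N → ℝ} (hx : x ∈ G.relint h) : x ∉ skel 𝒬 h m := by
  intro hx'
  obtain ⟨F, -, hFm, hxF⟩ := mem_skel.1 hx'
  have := Face.eq_of_mem_relint_of_mem_carrier hh hx hxF (by omega)
  subst this
  omega

/-- **The `m`-skeleton minus an open `m`-face `G` is the union of the other closed faces of
dimension `≤ m`** (for any `m`-face `G` of the lattice), hence closed. [folklore] -/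
theorem skel_diff_relint_eq (hh : 0 < h) {G : Face N} {m : ℕ}
    (hGm : G.S.card = m) : skel 𝒬 h m \ G.relint h =
      ⋃ F ∈ {F : Face N | F ∈ faces 𝒬 ∧ F.S.card ≤ m ∧ F ≠ G}, F.carrier h := by
  ext x
  simp only [mem_sdiff, mem_iUnion, mem_setOf_eq, exists_prop]
  constructor
  · rintro ⟨hx, hxG⟩
    obtain ⟨F, hF, hFm, hxF⟩ := mem_skel.1 hx
    by_cases hFG : F = G
    · subst hFG
      -- `x` is on the boundary of `G`, hence in a boundary face
      cases m with
      | zero =>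
        -- a `0`-face: `relint = carrier`
        exfalso
        refine hxG fun i => ⟨fun hi => ?_, fun hi => (hxF i).2 hi⟩
        have : F.S = ∅ := Finset.card_eq_zero.1 hGm
        simp [this] at hi
      | succ m =>
        obtain ⟨F', hF', hF'm, hxF'⟩ := mem_skel.1
          (Face.mem_skel_of_mem_carrier_diff_relint hF hGm.le hxF hxG)
        exact ⟨F', ⟨hF', by omega, fun heq => by subst heq; omega⟩, hxF'⟩
    · exact ⟨F, ⟨hF, hFm, hFG⟩, hxF⟩
  · rintro ⟨F, ⟨hF, hFm, hFG⟩, hxF⟩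
    refine ⟨mem_skel.2 ⟨F, hF, hFm, hxF⟩, fun hxG => hFG ?_⟩
    exact Face.eq_of_mem_relint_of_mem_carrier hh hxG hxF (by omega)

/-- `skel 𝒬 h m ∖ relint G` is closed for an `m`-face `G`. [folklore] -/
theorem isClosed_skel_diff_relint (hh : 0 < h) {G : Face N} {m : ℕ}
    (hGm : G.S.card = m) : IsClosed (skel 𝒬 h m \ G.relint h) := by
  rw [skel_diff_relint_eq hh hGm]
  exact ((faces_finite 𝒬).subset fun F hF => hF.1).isClosed_biUnion fun F _ =>
    F.isClosed_carrier h

end LatticeCube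

end Literature.Topology.Euclidean

end
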